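import Summits.ValiantsHypothesis.ValiantsHypothesis.Theorems.LacunarySymmetroidMatrixDescartesDoorA26WallBubblingMixGram
import Summits.ValiantsHypothesis.ValiantsHypothesis.Theorems.LacunarySymmetroidMatrixDescartesDoorA26WallBubblingNullCollapse
import Summits.ValiantsHypothesis.ValiantsHypothesis.Theorems.LacunarySymmetroidMatrixDescartesDoorA26WallBubblingRelativeDSieve

/-!
# Wall bubbling for `DoorA26` — WEYL TRIPLES: THE CLASS MOMENTS OF A TRIPLE IN FRAME LANGUAGE (the sixth slot is `O(s)`)

HONEST FRAMING.  Chain lemmas toward `TripleStratum26` of `Cruxes/DoorA26/Lines/wall_bubbling_ConfluentDoor.lean` (rev 13; crux `DoorA26`,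
stmt-ValiantsHypothesis-19979 — OPEN, typed, never asserted).  W1 seat val-sym-door-p2 g15 (#84).  ALGEBRA ONLY (def-free).  Three letters
`V₀,V₁,V₂ ∈ M₂(ℝ)` of a merging triple with deviations `x₀,x₁,x₂` (all `→ 0`); the class `2α` of the determinant has the nine ordered members
`polar(V_p,V_q)·e^{(x_p+x_q)t}` and its MOMENTS `M_m = Σ_{p,q} polar(V_p,V_q)(x_p+x_q)^m` are the function-level slot coefficients of #81–#83.  In the
FRAME MOMENTS `T_i = Σ_p x_p^i V_p` (so `T₀ = A`, `T₁ ≈ s·B`, `T₂ ≈ s²·C` of the Newton frame) and their polar Gram `A_ij = polar(T_i,T_j)`: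

* `tripleMoment_eq_frame` — `M_m = Σ_{i≤m} C(m,i)·polar(T_i, T_{m−i})` (bilinearity + binomial theorem);
* `tripleMoment_zero/one/two` — `M₀ = A₀₀`, `M₁ = 2A₀₁`, `M₂ = 2A₀₂ + 2A₁₁` (the cancelling pattern of W1 #80: the `t²`-slot carries two Gram entries);
* `tripleMoment_three/four/five` — `M₃ = 6A₁₂ + (e-terms)`, `M₄ = 6A₂₂ + (e-terms)`, **`M₅ = (e-terms only)`**, where every «e-term» carries a factor
  `e₁ = Σx`, `e₂ = Σ_{p<q} x_px_q` or `e₃ = x₀x₁x₂` (the frame recurrence `T_{i+3} = e₁T_{i+2} − e₂T_{i+1} + e₃T_i`): so the SIXTH slot `M₅` is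
  `O(s)·‖(A_ij)_{i,j≤2}‖` — alive in a normalised limit only if the frame Gram outgrows the function scale (the rigidity file's entry point);
* `mixedMoment_eq_frame` — a mixed class `α + δ_x` has moments `Σ_q polar(W,V_q) x_q^m = polar(W, T_m)`;
* `tripleMoment_symmetrise` — the nine ordered members have the moments of SIX weighted members (for #81 `momentTail` with `K = 6`).

Nothing here bears on `DoorA26`, `MatrixDescartes` (stmt-ValiantsHypothesis-18050) or `VP ≠ VNP`; `TripleStratum26`, (W), (M) OPEN.
`--supports stmt-ValiantsHypothesis-19979 --as helper`.  [folklore] Newton identities; bilinearity.  [this work] the slot bookkeeping of a triple.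
-/

-- `Summit.ValiantsHypothesis.ValiantsHypothesis.…` repeats a component by the D-0017 layout
-- (single-conjunct summit), which the `dupNamespace` linter flags; the name is mandated.
set_option linter.dupNamespace false

namespace Summit.ValiantsHypothesis.ValiantsHypothesis.Theorems.LacunarySymmetroidMatrixDescartes.WallBubbling

open Finset
open Bubbling (polar polar_apply polar_self)
open scoped BigOperators

/-! ## 1. Bilinearity of `polar` over finite sums (from the tree's `SecondOrder.polar_add_left'`, `polar_const_smul_left`) -/

/-- `polar` of a finite sum of scalar multiples on the left. [folklore] -/
theorem polarFrame_sum_smul_left {α : Type*} (s : Finset α) (c : α → ℝ) (S : α → Matrix (Fin 2) (Fin 2) ℝ)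
    (T : Matrix (Fin 2) (Fin 2) ℝ) : polar (∑ a ∈ s, c a • S a) T = ∑ a ∈ s, c a * polar (S a) T := by
  classical
  induction s using Finset.induction_on with
  | empty => simp [polar_apply]
  | insert a s ha ih => rw [Finset.sum_insert ha, Finset.sum_insert ha, SecondOrder.polar_add_left', polar_const_smul_left, ih]

/-- `polar` of two finite sums of scalar multiples. [folklore] -/
theorem polarFrame_sum_smul_sum_smul {α β : Type*} (s : Finset α) (s' : Finset β) (c : α → ℝ) (d : β → ℝ)
    (S : α → Matrix (Fin 2) (Fin 2) ℝ) (S' : β → Matrix (Fin 2) (Fin 2) ℝ) :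
    polar (∑ a ∈ s, c a • S a) (∑ b ∈ s', d b • S' b) = ∑ a ∈ s, ∑ b ∈ s', c a * d b * polar (S a) (S' b) := by
  rw [polarFrame_sum_smul_left]
  refine Finset.sum_congr rfl fun a _ => ?_
  rw [Bubbling.polar_comm, polarFrame_sum_smul_left, Finset.mul_sum]
  refine Finset.sum_congr rfl fun b _ => ?_
  rw [Bubbling.polar_comm]; ring

/-! ## 2. The class moments of a triple in frame language -/

/-- The polar Gram of frame moments in coordinates: `polar(T_i,T_j) = Σ_{p,q} x_p^i x_q^j polar(V_p,V_q)`. [this work] -/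
theorem frameGram_eq (V : Fin 3 → Matrix (Fin 2) (Fin 2) ℝ) (x : Fin 3 → ℝ) (i j : ℕ) :
    polar (∑ p, x p ^ i • V p) (∑ q, x q ^ j • V q) = ∑ p, ∑ q, x p ^ i * x q ^ j * polar (V p) (V q) :=
  polarFrame_sum_smul_sum_smul _ _ _ _ _ _

/-- **`M_m = Σ_{i≤m} C(m,i)·polar(T_i,T_{m−i})`**, `T_i = Σ_p x_p^i V_p`. [this work] -/
theorem tripleMoment_eq_frame (V : Fin 3 → Matrix (Fin 2) (Fin 2) ℝ) (x : Fin 3 → ℝ) (m : ℕ) :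
    ∑ p, ∑ q, polar (V p) (V q) * (x p + x q) ^ m
      = ∑ i ∈ Finset.range (m + 1), (m.choose i : ℝ) * polar (∑ p, x p ^ i • V p) (∑ q, x q ^ (m - i) • V q) := by
  simp only [frameGram_eq]
  rw [eq_comm]
  calc ∑ i ∈ Finset.range (m + 1), (m.choose i : ℝ) * ∑ p, ∑ q, x p ^ i * x q ^ (m - i) * polar (V p) (V q)
      = ∑ i ∈ Finset.range (m + 1), ∑ p, ∑ q, (m.choose i : ℝ) * (x p ^ i * x q ^ (m - i) * polar (V p) (V q)) := by
        simp only [Finset.mul_sum]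
    _ = ∑ p, ∑ i ∈ Finset.range (m + 1), ∑ q, (m.choose i : ℝ) * (x p ^ i * x q ^ (m - i) * polar (V p) (V q)) :=
        Finset.sum_comm
    _ = ∑ p, ∑ q, ∑ i ∈ Finset.range (m + 1), (m.choose i : ℝ) * (x p ^ i * x q ^ (m - i) * polar (V p) (V q)) :=
        Finset.sum_congr rfl fun p _ => Finset.sum_comm
    _ = ∑ p, ∑ q, polar (V p) (V q) * (x p + x q) ^ m := by
        refine Finset.sum_congr rfl fun p _ => Finset.sum_congr rfl fun q _ => ?_
        rw [add_pow, Finset.mul_sum]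
        exact Finset.sum_congr rfl fun i _ => by ring

/-- `M₀ = A₀₀`. [this work] -/
theorem tripleMoment_zero (V : Fin 3 → Matrix (Fin 2) (Fin 2) ℝ) (x : Fin 3 → ℝ) :
    ∑ p, ∑ q, polar (V p) (V q) * (x p + x q) ^ 0 = polar (∑ p, x p ^ 0 • V p) (∑ q, x q ^ 0 • V q) := by
  simp only [frameGram_eq]
  simp only [Fin.sum_univ_three]
  ring

/-- `M₁ = 2·A₀₁`. [this work] -/
theorem tripleMoment_one (V : Fin 3 → Matrix (Fin 2) (Fin 2) ℝ) (x : Fin 3 → ℝ) :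
    ∑ p, ∑ q, polar (V p) (V q) * (x p + x q) ^ 1 = 2 * polar (∑ p, x p ^ 0 • V p) (∑ q, x q ^ 1 • V q) := by
  simp only [frameGram_eq]
  simp only [Fin.sum_univ_three]
  rw [Bubbling.polar_comm (V 1) (V 0), Bubbling.polar_comm (V 2) (V 0), Bubbling.polar_comm (V 2) (V 1)]
  ring

/-- `M₂ = 2·A₀₂ + 2·A₁₁` — the `t²`-slot carries TWO Gram entries (W1 #80's cancelling pattern). [this work] -/
theorem tripleMoment_two (V : Fin 3 → Matrix (Fin 2) (Fin 2) ℝ) (x : Fin 3 → ℝ) :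
    ∑ p, ∑ q, polar (V p) (V q) * (x p + x q) ^ 2
      = 2 * polar (∑ p, x p ^ 0 • V p) (∑ q, x q ^ 2 • V q) + 2 * polar (∑ p, x p ^ 1 • V p) (∑ q, x q ^ 1 • V q) := by
  simp only [frameGram_eq]
  simp only [Fin.sum_univ_three]
  rw [Bubbling.polar_comm (V 1) (V 0), Bubbling.polar_comm (V 2) (V 0), Bubbling.polar_comm (V 2) (V 1)]
  ring

/-- **`M₃ = 6·A₁₂ + 2·(e₁A₀₂ − e₂A₀₁ + e₃A₀₀)`** with `e₁ = x₀+x₁+x₂`, `e₂ = x₀x₁+x₀x₂+x₁x₂`, `e₃ = x₀x₁x₂`. [this work] -/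
theorem tripleMoment_three (V : Fin 3 → Matrix (Fin 2) (Fin 2) ℝ) (x : Fin 3 → ℝ) :
    ∑ p, ∑ q, polar (V p) (V q) * (x p + x q) ^ 3
      = 6 * polar (∑ p, x p ^ 1 • V p) (∑ q, x q ^ 2 • V q)
        + 2 * ((x 0 + x 1 + x 2) * polar (∑ p, x p ^ 0 • V p) (∑ q, x q ^ 2 • V q)
          - (x 0 * x 1 + x 0 * x 2 + x 1 * x 2) * polar (∑ p, x p ^ 0 • V p) (∑ q, x q ^ 1 • V q)
          + (x 0 * x 1 * x 2) * polar (∑ p, x p ^ 0 • V p) (∑ q, x q ^ 0 • V q)) := by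
  simp only [frameGram_eq]
  simp only [Fin.sum_univ_three]
  rw [Bubbling.polar_comm (V 1) (V 0), Bubbling.polar_comm (V 2) (V 0), Bubbling.polar_comm (V 2) (V 1)]
  ring

/-- **`M₄ = 6·A₂₂ + (e-terms)`**. [this work] -/
theorem tripleMoment_four (V : Fin 3 → Matrix (Fin 2) (Fin 2) ℝ) (x : Fin 3 → ℝ) :
    ∑ p, ∑ q, polar (V p) (V q) * (x p + x q) ^ 4
      = 6 * polar (∑ p, x p ^ 2 • V p) (∑ q, x q ^ 2 • V q)
        + 2 * (((x 0 + x 1 + x 2) ^ 2 - (x 0 * x 1 + x 0 * x 2 + x 1 * x 2)) * polar (∑ p, x p ^ 0 • V p) (∑ q, x q ^ 2 • V q)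
          + (x 0 * x 1 * x 2 - (x 0 + x 1 + x 2) * (x 0 * x 1 + x 0 * x 2 + x 1 * x 2)) * polar (∑ p, x p ^ 0 • V p) (∑ q, x q ^ 1 • V q)
          + (x 0 + x 1 + x 2) * (x 0 * x 1 * x 2) * polar (∑ p, x p ^ 0 • V p) (∑ q, x q ^ 0 • V q))
        + 8 * ((x 0 + x 1 + x 2) * polar (∑ p, x p ^ 1 • V p) (∑ q, x q ^ 2 • V q)
          - (x 0 * x 1 + x 0 * x 2 + x 1 * x 2) * polar (∑ p, x p ^ 1 • V p) (∑ q, x q ^ 1 • V q)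
          + (x 0 * x 1 * x 2) * polar (∑ p, x p ^ 0 • V p) (∑ q, x q ^ 1 • V q)) := by
  simp only [frameGram_eq]
  simp only [Fin.sum_univ_three]
  rw [Bubbling.polar_comm (V 1) (V 0), Bubbling.polar_comm (V 2) (V 0), Bubbling.polar_comm (V 2) (V 1)]
  ring

/-- **`M₅ = (e-terms only)`**: every term of the sixth slot carries a factor `e₁`, `e₂` or `e₃`. [this work] -/
theorem tripleMoment_five (V : Fin 3 → Matrix (Fin 2) (Fin 2) ℝ) (x : Fin 3 → ℝ) :
    ∑ p, ∑ q, polar (V p) (V q) * (x p + x q) ^ 5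
      = 2 * (((x 0 + x 1 + x 2) ^ 3 - 2 * (x 0 + x 1 + x 2) * (x 0 * x 1 + x 0 * x 2 + x 1 * x 2) + x 0 * x 1 * x 2)
              * polar (∑ p, x p ^ 0 • V p) (∑ q, x q ^ 2 • V q)
          + ((x 0 + x 1 + x 2) * (x 0 * x 1 * x 2) - (x 0 + x 1 + x 2) ^ 2 * (x 0 * x 1 + x 0 * x 2 + x 1 * x 2)
              + (x 0 * x 1 + x 0 * x 2 + x 1 * x 2) ^ 2) * polar (∑ p, x p ^ 0 • V p) (∑ q, x q ^ 1 • V q)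
          + ((x 0 + x 1 + x 2) ^ 2 * (x 0 * x 1 * x 2) - (x 0 * x 1 + x 0 * x 2 + x 1 * x 2) * (x 0 * x 1 * x 2))
              * polar (∑ p, x p ^ 0 • V p) (∑ q, x q ^ 0 • V q))
        + 10 * ((((x 0 + x 1 + x 2) ^ 2 - (x 0 * x 1 + x 0 * x 2 + x 1 * x 2))) * polar (∑ p, x p ^ 1 • V p) (∑ q, x q ^ 2 • V q)
          + (x 0 * x 1 * x 2 - (x 0 + x 1 + x 2) * (x 0 * x 1 + x 0 * x 2 + x 1 * x 2)) * polar (∑ p, x p ^ 1 • V p) (∑ q, x q ^ 1 • V q)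
          + (x 0 + x 1 + x 2) * (x 0 * x 1 * x 2) * polar (∑ p, x p ^ 0 • V p) (∑ q, x q ^ 1 • V q))
        + 20 * ((x 0 + x 1 + x 2) * polar (∑ p, x p ^ 2 • V p) (∑ q, x q ^ 2 • V q)
          - (x 0 * x 1 + x 0 * x 2 + x 1 * x 2) * polar (∑ p, x p ^ 1 • V p) (∑ q, x q ^ 2 • V q)
          + (x 0 * x 1 * x 2) * polar (∑ p, x p ^ 0 • V p) (∑ q, x q ^ 2 • V q)) := by
  simp only [frameGram_eq]
  simp only [Fin.sum_univ_three]
  rw [Bubbling.polar_comm (V 1) (V 0), Bubbling.polar_comm (V 2) (V 0), Bubbling.polar_comm (V 2) (V 1)]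
  ring

/-! ## 3. Mixed classes and the symmetrised member set -/

/-- **Mixed moments**: `Σ_q polar(W,V_q)·x_q^m = polar(W, T_m)`. [this work] -/
theorem mixedMoment_eq_frame (W : Matrix (Fin 2) (Fin 2) ℝ) (V : Fin 3 → Matrix (Fin 2) (Fin 2) ℝ) (x : Fin 3 → ℝ) (m : ℕ) :
    ∑ q, polar W (V q) * x q ^ m = polar W (∑ q, x q ^ m • V q) := by
  rw [Bubbling.polar_comm, polarFrame_sum_smul_left]
  refine Finset.sum_congr rfl fun q _ => ?_
  rw [Bubbling.polar_comm]; ring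

/-- **Symmetrisation**: the nine ordered members of the class `2α` have the moments of the SIX weighted members `p ≤ q`
(weight `1` on the diagonal, `2` off it) — the member count `K = 6` that #81 `momentTail` is applied with. [this work] -/
theorem tripleMoment_symmetrise (V : Fin 3 → Matrix (Fin 2) (Fin 2) ℝ) (x : Fin 3 → ℝ) (m : ℕ) :
    ∑ p, ∑ q, polar (V p) (V q) * (x p + x q) ^ m
      = ∑ pq ∈ (Finset.univ.filter fun pq : Fin 3 × Fin 3 => pq.1 ≤ pq.2),
          ((if pq.1 = pq.2 then 1 else 2) * polar (V pq.1) (V pq.2)) * (x pq.1 + x pq.2) ^ m := by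
  have hset : (Finset.univ.filter fun pq : Fin 3 × Fin 3 => pq.1 ≤ pq.2)
      = {((0 : Fin 3), (0 : Fin 3)), (0, 1), (0, 2), (1, 1), (1, 2), (2, 2)} := by decide
  rw [hset]
  simp only [Fin.sum_univ_three]
  rw [Finset.sum_insert (by decide), Finset.sum_insert (by decide), Finset.sum_insert (by decide),
    Finset.sum_insert (by decide), Finset.sum_insert (by decide), Finset.sum_singleton]
  have h01 : polar (V 1) (V 0) = polar (V 0) (V 1) := Bubbling.polar_comm _ _
  have h02 : polar (V 2) (V 0) = polar (V 0) (V 2) := Bubbling.polar_comm _ _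
  have h12 : polar (V 2) (V 1) = polar (V 1) (V 2) := Bubbling.polar_comm _ _
  simp only [h01, h02, h12, Fin.isValue, if_true, show ((0 : Fin 3) = 1) = False by decide,
    show ((0 : Fin 3) = 2) = False by decide, show ((1 : Fin 3) = 2) = False by decide, if_false]
  ring

end Summit.ValiantsHypothesis.ValiantsHypothesis.Theorems.LacunarySymmetroidMatrixDescartes.WallBubbling
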